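import Literature.Barriers.RiemannHypothesis.MollifierLimitationsPropBQuadFormProofs
import Literature.Barriers.RiemannHypothesis.MollifierLimitationsSmallTheta
import HarnessLib

/-!
# Radziwiłł 2012, Proposition B: the first relation from the Balasubramanian–Conrey–Heath-Brown
# asymptotic — `Radziwill2012_propB_asymptotic_of_BCH`, `Radziwill2012_propB_of_BCH`

Sibling of `Literature/Barriers/RiemannHypothesis/MollifierLimitationsPropB.lean`, which vendors the
two printed relations of **Proposition B** of M. Radziwiłł, *Limitations to mollifying `ζ(s)`*
(arXiv:1207.6583) — the first relation `𝓘(M_θ) = 𝒬_T(a) − 1 + o(1)` (`θ < ½`; originally the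
named fact `Radziwill2012_propB_asymptotic`, since the D-0026 review of 2026-08-15 only the
spelled-out hypothesis of `Radziwill2012_propB_of_parts`, proved here) and the named fact
`Radziwill2012_propB_quadForm` (`𝒬_T(a) ≥ 1 + 1/θ + o(1)`, discharged in
`MollifierLimitationsPropBQuadFormProofs.lean`) — next to their deep input, the twisted second moment of Balasubramanian–Conrey–Heath-Brown 1985 in the form
quoted by Bettin–Chandee–Radziwiłł [BettinChandeeRadziwill2017, (1.2)]:
`BalasubramanianConreyHeathBrown1985_meanSquare`
(`T⁻¹∫_T^{2T} |ζ(½+it)A(½+it)|² dt = 𝒬_T(a) + o(1)` for `θ < ½`, uniformly over `a_n ≪ n^ε`).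

That file records the first relation as "the previous fact combined with the first moment
`T⁻¹∫_T^{2T} ζ(½+it)M_θ(½+it) dt → a(1) = 1` (to be derived in a sibling file)". This is that
sibling file: everything here is PROVED, no named fact is introduced, and the outcome is that
**Proposition B, and with it the printed route to Theorem 1 for `θ < ½`, rests on the single
named fact `BalasubramanianConreyHeathBrown1985_meanSquare`**:

* `PropBAsymptotic.norm_firstMoment_sub_le` — **the twisted first moment**, elementary and
  effective: for `T ≥ 2`, `N ≥ 1` and arbitrary coefficients,
  `‖∫_T^{2T} ζ(½+it) M(½+it) dt − a(1)·T‖ ≤ (19 + C(1)) · A_½ · T^{3/4}`,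
  `A_½ = Σ_{d ≤ N} |a(d)| d^{-½}`, `M(s) = Σ_{d ≤ N} a(d) d^{-s}` (`C(1)` the Euler–Maclaurin constant
  `SmallTheta.emC`). Proof: `ζ(½+it) = Σ_{n < L} n^{-½-it} + O(T^{-1/4})` on `[T, 2T]` with
  `L = ⌈(2T)^{3/2}⌉` (the tree's `SmallTheta.norm_zeta_sub_zetaSum_le`, Titchmarsh §4.11);
  multiplying out, `∫_T^{2T} D_L M dt = Σ_{d ≤ N} Σ_{n < L} a(d)(nd)^{-½} ∫_T^{2T} (nd)^{-it} dt`, the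
  diagonal `nd = 1` contributes `a(1)T`, and off it `|∫_T^{2T} (nd)^{-it} dt| ≤ 2/log(nd) ≤ 2/log 2 ≤ 4`,
  so the rest is at most `4 · A_½ · Σ_{n<L} n^{-½} ≤ 16 A_½ T^{3/4}`; the Euler–Maclaurin error
  contributes `≤ (C(1)+3) T^{-1/4} · A_½ · T`.
* `PropBAsymptotic.integral_norm_one_sub_sq` — `∫_T^{2T} |1 − F|² = T − 2 Re ∫_T^{2T} F + ∫_T^{2T} |F|²`
  for continuous `F`.
* `Radziwill2012_propB_asymptotic_of_BCH` — **the first relation of Proposition B from the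
  Balasubramanian–Conrey–Heath-Brown asymptotic**: with `F = ζM_θ`, `N = ⌊T^θ⌋`, `θ < ½` and
  `|a(n)| ≤ C(δ)n^δ`, `A_½ ≤ 2C(δ) T^{θ(½+δ)}`; choosing `δ = (1 − 2θ)/(8θ)` the first-moment error
  after division by `T` is `≪_{θ,C} T^{-(1−2θ)/8} → 0`, so `T⁻¹ Re ∫ ζM_θ = 1 + o(1)` (using
  `a(1) = 1`), and `𝓘(M_θ) = 1 − 2(1 + o(1)) + (𝒬_T(a) + o(1)) = 𝒬_T(a) − 1 + o(1)`, uniformly over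
  the admissible class — the first relation exactly as vendored (spelled out in the statement).
* `Radziwill2012_propB_of_BCH` — hence **Proposition B from the single named fact**
  `BalasubramanianConreyHeathBrown1985_meanSquare` (with the discharged
  `Radziwill2012_propB_quadForm_holds`); the closing anonymous `example` records that Selberg's
  lemma, Bombieri–Friedlander's Lemma 2 and the BCH asymptotic then compose, along the printed
  route, literally to `Radziwill2012_thm1`. As a statement that composite is
  `Radziwill2012_thm1_of_selberg_of_lemma2` (`MollifierLimitationsSmallTheta.lean`) under a
  redundant third hypothesis, so its former name `Radziwill2012_thm1_of_selberg_lemma2_BCH`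
  (a deprecated alias since dedup-00596) was deleted, dedup-00672: use
  `Radziwill2012_thm1_of_selberg_of_lemma2`.

Design note (D-0026 review of the decomposition of `Radziwill2012_propB`, 2026-08-15): the fact
`BalasubramanianConreyHeathBrown1985_meanSquare` is the canonical published theorem (general
coefficients, no normalisation `a(1) = 1`), faithful to [BettinChandeeRadziwill2017, (1.2)] and to the
remainder form quoted in [Yu2023, §1] (`E ≪ M²T^ε + T log^{-c} T` for `∫_0^T`, differenced over
`[T, 2T]`), and genuinely beyond the present library (approximate functional equation, mean values of
Dirichlet polynomials of `t`-dependent length, the off-diagonal analysis of the paper); it is kept as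
the one deep leaf, and the Radziwiłł-specific corollary (Prop. B's first relation, formerly the
`def Radziwill2012_propB_asymptotic`) is proved from it here rather than carried as independent debt.

## References

* [Radziwill2012] M. Radziwiłł, *Limitations to mollifying ζ(s)*, arXiv:1207.6583 (2012), Prop. B
  (p. 3: "using an asymptotic formula for `𝓘`, due to Balasubramanian, Conrey and Heath-Brown").
* [BettinChandeeRadziwill2017] S. Bettin, V. Chandee, M. Radziwiłł, *The mean square of the product
  of the Riemann zeta-function with Dirichlet polynomials*, J. reine angew. Math. 729 (2017) =
  arXiv:1411.7764, §1, (1.1)–(1.2) (pp. 1–2).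
* [BalasubramanianConreyHeathBrown1985] R. Balasubramanian, J. B. Conrey, D. R. Heath-Brown,
  *Asymptotic mean square of the product of the Riemann zeta-function and a Dirichlet polynomial*,
  J. reine angew. Math. 357 (1985), 161–181.
* [Yu2023] J. Yu, arXiv:2312.10614, §1 (BCH's theorem with its remainder).
* [Titchmarsh1986] E. C. Titchmarsh, *The Theory of the Riemann Zeta-Function*, 2nd ed., §4.11.
-/

noncomputable section

open Complex MeasureTheory Real Set Finset

namespace Literature.Barriers.RiemannHypothesis

namespace PropBAsymptotic

open SmallTheta

/-! ## §1 The mollifier on the critical line -/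

/-- `|M(½+it)| ≤ A_½ = Σ_{d ≤ N} |a(d)| d^{-½}`. [folklore] -/
theorem norm_mollifierLine_le_half (a : ℕ → ℂ) (N : ℕ) (t : ℝ) :
    ‖mollifierLine a N t‖ ≤ ∑ d ∈ Finset.Icc 1 N, ‖a d‖ * (d : ℝ) ^ (-(1 / 2 : ℝ)) := by
  rw [mollifierLine_eq_sum]
  refine (norm_sum_le _ _).trans (Finset.sum_le_sum fun d _ ↦ ?_)
  rw [norm_mul, norm_mul, norm_halfPow, norm_linePhase, mul_one]

/-- `A_½ ≥ 0`. [folklore] -/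
theorem coeffHalfSum_nonneg (a : ℕ → ℂ) (N : ℕ) :
    0 ≤ ∑ d ∈ Finset.Icc 1 N, ‖a d‖ * (d : ℝ) ^ (-(1 / 2 : ℝ)) :=
  Finset.sum_nonneg fun d _ ↦ mul_nonneg (norm_nonneg _) (Real.rpow_nonneg (Nat.cast_nonneg d) _)

/-- **`A_½` for admissible coefficients**: if `|a(n)| ≤ K n^δ` (`n ≥ 1`, `K, δ ≥ 0`) then
`A_½ = Σ_{d ≤ N} |a(d)| d^{-½} ≤ K N^δ Σ_{d ≤ N} d^{-½} ≤ 2K N^{½+δ}`. [folklore] -/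
theorem coeffHalfSum_le {a : ℕ → ℂ} {K δ : ℝ} (hK : 0 ≤ K) (hδ : 0 ≤ δ)
    (ha : ∀ n : ℕ, 1 ≤ n → ‖a n‖ ≤ K * (n : ℝ) ^ δ) (N : ℕ) :
    ∑ d ∈ Finset.Icc 1 N, ‖a d‖ * (d : ℝ) ^ (-(1 / 2 : ℝ)) ≤
      2 * K * (N : ℝ) ^ (1 / 2 + δ) := by
  have hN0 : (0 : ℝ) ≤ N := Nat.cast_nonneg N
  calc ∑ d ∈ Finset.Icc 1 N, ‖a d‖ * (d : ℝ) ^ (-(1 / 2 : ℝ))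
      ≤ ∑ d ∈ Finset.Icc 1 N, K * (N : ℝ) ^ δ * (d : ℝ) ^ (-(1 / 2 : ℝ)) := by
        refine Finset.sum_le_sum fun d hd ↦ ?_
        rw [Finset.mem_Icc] at hd
        refine mul_le_mul_of_nonneg_right ?_ (Real.rpow_nonneg (Nat.cast_nonneg d) _)
        refine (ha d hd.1).trans (mul_le_mul_of_nonneg_left ?_ hK)
        exact Real.rpow_le_rpow (Nat.cast_nonneg d) (by exact_mod_cast hd.2) hδ
    _ = K * (N : ℝ) ^ δ * ∑ d ∈ Finset.Icc 1 N, (d : ℝ) ^ (-(1 / 2 : ℝ)) := by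
        rw [Finset.mul_sum]
    _ ≤ K * (N : ℝ) ^ δ * (2 * Real.sqrt N) :=
        mul_le_mul_of_nonneg_left
          (Literature.NumberTheory.LFunctions.AFE.sum_Icc_rpow_neg_half_le N)
          (mul_nonneg hK (Real.rpow_nonneg hN0 _))
    _ = 2 * K * (N : ℝ) ^ (1 / 2 + δ) := by
        rw [Real.sqrt_eq_rpow, Real.rpow_add' hN0 (ne_of_gt (by positivity))]
        ring

/-! ## §2 The main part `D_L · M` of the twisted first moment -/

/-- **Expansion of the integrand**:
`D_L(t) M(½+it) = Σ_{d ≤ N} Σ_{n < L} a(d) d^{-½} n^{-½} e^{-it(log n + log d)}`. [folklore] -/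
theorem zetaSum_mul_mollifierLine_eq (a : ℕ → ℂ) (N L : ℕ) (t : ℝ) :
    zetaSum L t * mollifierLine a N t =
      ∑ d ∈ Finset.Icc 1 N, ∑ n ∈ Finset.Ico 1 L,
        a d * halfPow d * halfPow n * linePhase (Real.log n + Real.log d) t := by
  rw [mollifierLine_eq_sum, zetaSum, Finset.sum_mul_sum, Finset.sum_comm]
  refine Finset.sum_congr rfl fun d _ ↦ Finset.sum_congr rfl fun n _ ↦ ?_
  rw [linePhase_add]
  ring

/-- **The main part as a double sum of phase integrals**:
`∫_T^{2T} D_L M dt = Σ_{d ≤ N} Σ_{n < L} a(d) d^{-½} n^{-½} ∫_T^{2T} e^{-it(log n + log d)} dt`.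
[folklore] -/
theorem integral_zetaSum_mul_mollifierLine_eq (a : ℕ → ℂ) (N L : ℕ) (T : ℝ) :
    ∫ t in T..(2 * T), zetaSum L t * mollifierLine a N t =
      ∑ d ∈ Finset.Icc 1 N, ∑ n ∈ Finset.Ico 1 L,
        a d * halfPow d * halfPow n *
          ∫ t in T..(2 * T), linePhase (Real.log n + Real.log d) t := by
  simp_rw [zetaSum_mul_mollifierLine_eq]
  rw [intervalIntegral.integral_finsetSum]
  · refine Finset.sum_congr rfl fun d _ ↦ ?_
    rw [intervalIntegral.integral_finsetSum]
    · refine Finset.sum_congr rfl fun n _ ↦ ?_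
      exact intervalIntegral.integral_const_mul _ _
    · exact fun n _ ↦ (continuous_const.mul (continuous_linePhase _)).intervalIntegrable _ _
  · exact fun d _ ↦ (continuous_finsetSum _ fun n _ ↦
      continuous_const.mul (continuous_linePhase _)).intervalIntegrable _ _

/-- On the diagonal `nd = 1` (i.e. `n = d = 1`) the phase integral is `T`. [folklore] -/
theorem integral_linePhase_log_of_mul_eq_one {n d : ℕ} (h : n * d = 1) (T : ℝ) :
    ∫ t in T..(2 * T), linePhase (Real.log n + Real.log d) t = (T : ℂ) := by
  have hn : n = 1 := Nat.eq_one_of_mul_eq_one_right h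
  have hd : d = 1 := Nat.eq_one_of_mul_eq_one_left h
  subst hn
  subst hd
  simp only [Nat.cast_one, Real.log_one, add_zero]
  rw [integral_linePhase_zero]
  push_cast
  ring

/-- Off the diagonal (`nd ≥ 2`): the frequency is `log(nd) ≥ log 2 ≥ ½`, so
`‖∫_T^{2T} e^{-it(log n + log d)} dt‖ ≤ 2/log 2 ≤ 4`. [folklore] -/
theorem norm_integral_linePhase_log_le {n d : ℕ} (hn : n ≠ 0) (hd : d ≠ 0) (h : n * d ≠ 1)
    (T : ℝ) : ‖∫ t in T..(2 * T), linePhase (Real.log n + Real.log d) t‖ ≤ 4 := by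
  have h2 : 1 < n * d := Nat.one_lt_iff_ne_zero_and_ne_one.2 ⟨mul_ne_zero hn hd, h⟩
  have hn0 : (0 : ℝ) < n := by exact_mod_cast Nat.pos_of_ne_zero hn
  have hd0 : (0 : ℝ) < d := by exact_mod_cast Nat.pos_of_ne_zero hd
  have hν : Real.log 2 ≤ Real.log n + Real.log d := by
    rw [← Real.log_mul hn0.ne' hd0.ne']
    refine Real.log_le_log (by norm_num) ?_
    exact_mod_cast h2
  have hl2 := half_le_log_two
  have hpos : 0 < Real.log n + Real.log d := by linarith
  refine (norm_integral_linePhase_le hpos.ne' _ _).trans ?_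
  rw [abs_of_pos hpos, div_le_iff₀ hpos]
  linarith

/-- **Diagonal and off-diagonal**: for `N ≥ 1` and `L ≥ 2`,
`‖∫_T^{2T} D_L M dt − a(1)·T‖ ≤ 4 · A_½ · Σ_{n < L} n^{-½}` (the term `n = d = 1` is `a(1)T`;
every other phase integral has norm `≤ 4`). [folklore] -/
theorem norm_integral_zetaSum_mul_sub_le (a : ℕ → ℂ) {N L : ℕ} (hN : 1 ≤ N) (hL : 2 ≤ L)
    (T : ℝ) :
    ‖(∫ t in T..(2 * T), zetaSum L t * mollifierLine a N t) - a 1 * T‖ ≤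
      4 * (∑ d ∈ Finset.Icc 1 N, ‖a d‖ * (d : ℝ) ^ (-(1 / 2 : ℝ))) *
        ∑ n ∈ Finset.Ico 1 L, (n : ℝ) ^ (-(1 / 2 : ℝ)) := by
  rw [integral_zetaSum_mul_mollifierLine_eq]
  set c : ℕ → ℕ → ℂ := fun d n ↦ a d * halfPow d * halfPow n with hc
  set P : ℕ → ℕ → ℂ := fun d n ↦
    ∫ t in T..(2 * T), linePhase (Real.log n + Real.log d) t with hP
  set Q : ℕ → ℕ → ℂ := fun d n ↦ if n * d = 1 then 0 else P d n with hQ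
  -- split each term into its diagonal part and the rest
  have hsplit : ∀ d ∈ Finset.Icc 1 N, ∀ n ∈ Finset.Ico 1 L,
      c d n * P d n = (if n * d = 1 then a 1 * (T : ℂ) else 0) + c d n * Q d n := by
    intro d _ n _
    simp only [hQ]
    split_ifs with h
    · have hn1 : n = 1 := Nat.eq_one_of_mul_eq_one_right h
      have hd1 : d = 1 := Nat.eq_one_of_mul_eq_one_left h
      subst hn1
      subst hd1
      simp only [hc, hP, mul_zero, add_zero]
      rw [integral_linePhase_log_of_mul_eq_one h, halfPow_one]
      ring
    · simp
  have hdiag : ∑ d ∈ Finset.Icc 1 N, ∑ n ∈ Finset.Ico 1 L,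
      (if n * d = 1 then a 1 * (T : ℂ) else 0) = a 1 * T := by
    have h1 : ∀ d ∈ Finset.Icc 1 N, ∑ n ∈ Finset.Ico 1 L,
        (if n * d = 1 then a 1 * (T : ℂ) else 0) = if d = 1 then a 1 * (T : ℂ) else 0 := by
      intro d _
      split_ifs with hd1
      · subst hd1
        simp_rw [mul_one]
        rw [Finset.sum_ite_eq' (Finset.Ico 1 L) 1 (fun _ ↦ a 1 * (T : ℂ)), if_pos]
        rw [Finset.mem_Ico]; omega
      · refine Finset.sum_eq_zero fun n _ ↦ ?_
        rw [if_neg]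
        exact fun h ↦ hd1 (Nat.eq_one_of_mul_eq_one_left h)
    rw [Finset.sum_congr rfl h1, Finset.sum_ite_eq' (Finset.Icc 1 N) 1 (fun _ ↦ a 1 * (T : ℂ)),
      if_pos (Finset.mem_Icc.2 ⟨le_rfl, hN⟩)]
  have hQle : ∀ d ∈ Finset.Icc 1 N, ∀ n ∈ Finset.Ico 1 L, ‖Q d n‖ ≤ 4 := by
    intro d hd n hn
    rw [Finset.mem_Icc] at hd
    rw [Finset.mem_Ico] at hn
    simp only [hQ]
    split_ifs with h
    · simp
    · exact norm_integral_linePhase_log_le (by omega) (by omega) h T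
  -- the main computation
  have hstep : ∑ d ∈ Finset.Icc 1 N, ∑ n ∈ Finset.Ico 1 L, c d n * P d n =
      a 1 * T + ∑ d ∈ Finset.Icc 1 N, ∑ n ∈ Finset.Ico 1 L, c d n * Q d n := by
    rw [Finset.sum_congr rfl fun d hd ↦ Finset.sum_congr rfl fun n hn ↦ hsplit d hd n hn]
    simp_rw [Finset.sum_add_distrib]
    rw [hdiag]
  have hstep' : (∑ d ∈ Finset.Icc 1 N, ∑ n ∈ Finset.Ico 1 L,
      a d * halfPow d * halfPow n * ∫ t in T..(2 * T), linePhase (Real.log n + Real.log d) t) =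
      a 1 * T + ∑ d ∈ Finset.Icc 1 N, ∑ n ∈ Finset.Ico 1 L, c d n * Q d n := hstep
  rw [hstep', add_sub_cancel_left]
  calc ‖∑ d ∈ Finset.Icc 1 N, ∑ n ∈ Finset.Ico 1 L, c d n * Q d n‖
      ≤ ∑ d ∈ Finset.Icc 1 N, ∑ n ∈ Finset.Ico 1 L, ‖c d n‖ * 4 := by
        refine (norm_sum_le _ _).trans (Finset.sum_le_sum fun d hd ↦ ?_)
        refine (norm_sum_le _ _).trans (Finset.sum_le_sum fun n hn ↦ ?_)
        rw [norm_mul]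
        exact mul_le_mul_of_nonneg_left (hQle d hd n hn) (norm_nonneg _)
    _ = 4 * ((∑ d ∈ Finset.Icc 1 N, ‖a d‖ * (d : ℝ) ^ (-(1 / 2 : ℝ))) *
          ∑ n ∈ Finset.Ico 1 L, (n : ℝ) ^ (-(1 / 2 : ℝ))) := by
        rw [Finset.sum_mul_sum, Finset.mul_sum]
        refine Finset.sum_congr rfl fun d _ ↦ ?_
        rw [Finset.mul_sum]
        refine Finset.sum_congr rfl fun n _ ↦ ?_
        simp only [hc, norm_mul, norm_halfPow]
        ring
    _ = _ := by ring

/-! ## §3 The Euler–Maclaurin error and the first moment -/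

/-- **The Euler–Maclaurin error in the first moment**: for `T ≥ 2` and
`(2T)^{3/2} ≤ L ≤ (2T)^{3/2} + 1`, `‖∫_T^{2T} (ζ − D_L)(½+it) M(½+it) dt‖ ≤ (C(1)+3) T^{-1/4} · A_½ · T`.
[folklore] -/
theorem norm_integral_emError_mul_le (a : ℕ → ℂ) (N : ℕ) {T : ℝ} (hT : 2 ≤ T) {L : ℕ}
    (hL : (2 * T) ^ (3 / 2 : ℝ) ≤ L) (hL' : (L : ℝ) ≤ (2 * T) ^ (3 / 2 : ℝ) + 1) :
    ‖∫ t in T..(2 * T), (riemannZeta (1 / 2 + t * I) - zetaSum L t) * mollifierLine a N t‖ ≤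
      (emC + 3) * T ^ (-(1 / 4 : ℝ)) *
        (∑ d ∈ Finset.Icc 1 N, ‖a d‖ * (d : ℝ) ^ (-(1 / 2 : ℝ))) * T := by
  have hT0 : 0 < T := by linarith
  have h := intervalIntegral.norm_integral_le_of_norm_le_const (a := T) (b := 2 * T)
    (f := fun t ↦ (riemannZeta (1 / 2 + t * I) - zetaSum L t) * mollifierLine a N t)
    (C := (emC + 3) * T ^ (-(1 / 4 : ℝ)) *
      ∑ d ∈ Finset.Icc 1 N, ‖a d‖ * (d : ℝ) ^ (-(1 / 2 : ℝ))) ?_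
  · rw [show |2 * T - T| = T by rw [show 2 * T - T = T by ring, abs_of_pos hT0]] at h
    exact h
  · intro t ht
    rw [Set.uIoc_of_le (by linarith)] at ht
    have ht' : t ∈ Set.Icc T (2 * T) := ⟨ht.1.le, ht.2⟩
    rw [norm_mul]
    have h1 := norm_zeta_sub_zetaSum_le hT ht' hL hL'
    have h2 := norm_mollifierLine_le_half a N t
    have h0 : 0 ≤ (emC + 3) * T ^ (-(1 / 4 : ℝ)) := by
      have := emC_nonneg; positivity
    exact mul_le_mul h1 h2 (norm_nonneg _) h0

/-- **The twisted first moment.** For `T ≥ 2`, `N ≥ 1` and any coefficients `a`,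
`‖∫_T^{2T} ζ(½+it) M(½+it) dt − a(1)·T‖ ≤ (19 + C(1)) · A_½ · T^{3/4}`,
`A_½ = Σ_{d ≤ N} |a(d)| d^{-½}`: Euler–Maclaurin with `L = ⌈(2T)^{3/2}⌉` (`√L ≤ 2T^{3/4}`,
`Σ_{n < L} n^{-½} ≤ 2√L`), the diagonal `n = d = 1`, and `|∫ e^{-itν}| ≤ 2/|ν|` with
`ν = log(nd) ≥ log 2` off it. [folklore] -/
theorem norm_firstMoment_sub_le (a : ℕ → ℂ) {N : ℕ} (hN : 1 ≤ N) {T : ℝ} (hT : 2 ≤ T) :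
    ‖(∫ t in T..(2 * T), riemannZeta (1 / 2 + t * I) * mollifierLine a N t) - a 1 * T‖ ≤
      (19 + emC) * (∑ d ∈ Finset.Icc 1 N, ‖a d‖ * (d : ℝ) ^ (-(1 / 2 : ℝ))) *
        T ^ (3 / 4 : ℝ) := by
  have hT0 : 0 < T := by linarith
  have hT1 : (1 : ℝ) ≤ T := by linarith
  set A : ℝ := ∑ d ∈ Finset.Icc 1 N, ‖a d‖ * (d : ℝ) ^ (-(1 / 2 : ℝ)) with hA
  have hA0 : 0 ≤ A := coeffHalfSum_nonneg a N
  set L := ⌈(2 * T) ^ (3 / 2 : ℝ)⌉₊ with hL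
  have hLge : (2 * T) ^ (3 / 2 : ℝ) ≤ L := Nat.le_ceil _
  have hLle : (L : ℝ) ≤ (2 * T) ^ (3 / 2 : ℝ) + 1 :=
    (Nat.ceil_lt_add_one (Real.rpow_nonneg (by positivity) _)).le
  -- `L ≥ 2`
  have h2T : 2 * T ≤ (2 * T) ^ (3 / 2 : ℝ) := by
    have h1 : (2 * T) ^ (1 : ℝ) ≤ (2 * T) ^ (3 / 2 : ℝ) :=
      Real.rpow_le_rpow_of_exponent_le (by linarith) (by norm_num)
    rwa [Real.rpow_one] at h1
  have hL2 : 2 ≤ L := by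
    have : (2 : ℝ) ≤ L := by linarith
    exact_mod_cast this
  -- `√L ≤ 2 T^{3/4}`
  have hsL : Real.sqrt L ≤ 2 * T ^ (3 / 4 : ℝ) := by
    have h1 : (L : ℝ) ≤ 4 * T ^ (3 / 2 : ℝ) := by
      have h2 : (2 * T) ^ (3 / 2 : ℝ) = 2 ^ (3 / 2 : ℝ) * T ^ (3 / 2 : ℝ) :=
        Real.mul_rpow (by norm_num) hT0.le
      have h3 : (2 : ℝ) ^ (3 / 2 : ℝ) ≤ 3 := by
        have : (2 : ℝ) ^ (3 / 2 : ℝ) = Real.sqrt 8 := by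
          rw [show (8 : ℝ) = 2 ^ (3 : ℝ) by norm_num, Real.sqrt_eq_rpow,
            ← Real.rpow_mul (by norm_num)]
          norm_num
        rw [this, Real.sqrt_le_left (by norm_num)]; norm_num
      have h4 : 1 ≤ T ^ (3 / 2 : ℝ) := Real.one_le_rpow hT1 (by norm_num)
      have h5 : (2 : ℝ) ^ (3 / 2 : ℝ) * T ^ (3 / 2 : ℝ) ≤ 3 * T ^ (3 / 2 : ℝ) :=
        mul_le_mul_of_nonneg_right h3 (Real.rpow_nonneg hT0.le _)
      rw [h2] at hLle
      linarith
    calc Real.sqrt L ≤ Real.sqrt (4 * T ^ (3 / 2 : ℝ)) := Real.sqrt_le_sqrt h1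
      _ = 2 * T ^ (3 / 4 : ℝ) := by
          rw [Real.sqrt_mul (by norm_num), show (4 : ℝ) = 2 ^ 2 by norm_num,
            Real.sqrt_sq (by norm_num), Real.sqrt_eq_rpow, ← Real.rpow_mul hT0.le]
          norm_num
  have hsum : ∑ n ∈ Finset.Ico 1 L, (n : ℝ) ^ (-(1 / 2 : ℝ)) ≤ 2 * Real.sqrt L :=
    sum_rpow_neg_half_le_of_subset Finset.Ico_subset_Icc_self
  -- continuity and the splitting `ζ M = (ζ - D_L) M + D_L M`
  have hζc : Continuous fun t : ℝ ↦ riemannZeta (1 / 2 + t * I) := continuous_riemannZeta_half_line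
  have hMc : Continuous (mollifierLine a N) := continuous_mollifierLine a N
  have hDc : Continuous (zetaSum L) := continuous_zetaSum L
  have hi1 : IntervalIntegrable
      (fun t : ℝ ↦ (riemannZeta (1 / 2 + t * I) - zetaSum L t) * mollifierLine a N t)
      volume T (2 * T) := ((hζc.sub hDc).mul hMc).intervalIntegrable _ _
  have hi2 : IntervalIntegrable (fun t : ℝ ↦ zetaSum L t * mollifierLine a N t) volume T (2 * T) :=
    (hDc.mul hMc).intervalIntegrable _ _
  have hsplit : (∫ t in T..(2 * T), riemannZeta (1 / 2 + t * I) * mollifierLine a N t) =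
      (∫ t in T..(2 * T), (riemannZeta (1 / 2 + t * I) - zetaSum L t) * mollifierLine a N t) +
        ∫ t in T..(2 * T), zetaSum L t * mollifierLine a N t := by
    rw [← intervalIntegral.integral_add hi1 hi2]
    refine intervalIntegral.integral_congr fun t _ ↦ ?_
    ring
  have h1 := norm_integral_emError_mul_le a N hT hLge hLle
  have h2 := norm_integral_zetaSum_mul_sub_le a hN hL2 T
  -- numerics
  have hpow : T ^ (-(1 / 4 : ℝ)) * T = T ^ (3 / 4 : ℝ) := by
    conv_lhs => rw [show (T : ℝ) = T ^ (1 : ℝ) from (Real.rpow_one T).symm, ← Real.rpow_mul hT0.le,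
      ← Real.rpow_add hT0]
    norm_num
  have hC := emC_nonneg
  have hE1 : ‖∫ t in T..(2 * T), (riemannZeta (1 / 2 + t * I) - zetaSum L t) * mollifierLine a N t‖ ≤
      (emC + 3) * A * T ^ (3 / 4 : ℝ) := by
    refine h1.trans (le_of_eq ?_)
    rw [← hpow]; ring
  have hE2 : ‖(∫ t in T..(2 * T), zetaSum L t * mollifierLine a N t) - a 1 * T‖ ≤
      16 * A * T ^ (3 / 4 : ℝ) := by
    refine h2.trans ?_
    calc 4 * A * ∑ n ∈ Finset.Ico 1 L, (n : ℝ) ^ (-(1 / 2 : ℝ)) ≤ 4 * A * (2 * Real.sqrt L) :=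
          mul_le_mul_of_nonneg_left hsum (by positivity)
      _ ≤ 4 * A * (2 * (2 * T ^ (3 / 4 : ℝ))) := by gcongr
      _ = 16 * A * T ^ (3 / 4 : ℝ) := by ring
  rw [hsplit]
  calc ‖(∫ t in T..(2 * T), (riemannZeta (1 / 2 + t * I) - zetaSum L t) * mollifierLine a N t) +
        (∫ t in T..(2 * T), zetaSum L t * mollifierLine a N t) - a 1 * T‖
      = ‖(∫ t in T..(2 * T), (riemannZeta (1 / 2 + t * I) - zetaSum L t) * mollifierLine a N t) +
        ((∫ t in T..(2 * T), zetaSum L t * mollifierLine a N t) - a 1 * T)‖ := by rw [add_sub_assoc]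
    _ ≤ (emC + 3) * A * T ^ (3 / 4 : ℝ) + 16 * A * T ^ (3 / 4 : ℝ) :=
        (norm_add_le _ _).trans (add_le_add hE1 hE2)
    _ = (19 + emC) * A * T ^ (3 / 4 : ℝ) := by ring

/-! ## §4 The `L²` expansion of the defect -/

/-- `|1 − w|² = 1 − 2 Re w + |w|²`. [folklore] -/
theorem norm_one_sub_sq (w : ℂ) : ‖1 - w‖ ^ 2 = 1 - 2 * w.re + ‖w‖ ^ 2 := by
  rw [Complex.sq_norm, Complex.sq_norm, Complex.normSq_apply, Complex.normSq_apply]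
  simp only [Complex.sub_re, Complex.one_re, Complex.sub_im, Complex.one_im]
  ring

/-- **The `L²` expansion**: for continuous `F`,
`∫_T^{2T} |1 − F|² dt = T − 2 Re ∫_T^{2T} F dt + ∫_T^{2T} |F|² dt`. [folklore] -/
theorem integral_norm_one_sub_sq {F : ℝ → ℂ} (hF : Continuous F) (T : ℝ) :
    ∫ t in T..(2 * T), ‖1 - F t‖ ^ 2 =
      T - 2 * (∫ t in T..(2 * T), F t).re + ∫ t in T..(2 * T), ‖F t‖ ^ 2 := by
  simp_rw [norm_one_sub_sq]
  have hre : Continuous fun t ↦ (F t).re := Complex.continuous_re.comp hF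
  have hi1 : IntervalIntegrable (fun t ↦ (1 : ℝ) - 2 * (F t).re) volume T (2 * T) :=
    (continuous_const.sub (continuous_const.mul hre)).intervalIntegrable _ _
  have hi2 : IntervalIntegrable (fun t ↦ ‖F t‖ ^ 2) volume T (2 * T) :=
    ((hF.norm).pow 2).intervalIntegrable _ _
  have hi3 : IntervalIntegrable (fun _ ↦ (1 : ℝ)) volume T (2 * T) :=
    intervalIntegrable_const (μ := volume)
  have hi4 : IntervalIntegrable (fun t ↦ 2 * (F t).re) volume T (2 * T) :=
    (continuous_const.mul hre).intervalIntegrable _ _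
  rw [intervalIntegral.integral_add hi1 hi2, intervalIntegral.integral_sub hi3 hi4,
    intervalIntegral.integral_const_mul, intervalIntegral.integral_const]
  have hcomm : ∫ t in T..(2 * T), (F t).re = (∫ t in T..(2 * T), F t).re := by
    have h := Complex.reCLM.intervalIntegral_comp_comm (hF.intervalIntegrable (μ := volume) T (2 * T))
    simpa using h
  rw [hcomm]
  simp only [smul_eq_mul, mul_one]
  ring

end PropBAsymptotic

/-! ## §5 Proposition B from the Balasubramanian–Conrey–Heath-Brown asymptotic -/

open PropBAsymptotic SmallTheta in
/-- **Radziwiłł 2012, Proposition B, first relation, from the Balasubramanian–Conrey–Heath-Brown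
asymptotic.** `BalasubramanianConreyHeathBrown1985_meanSquare` (the twisted second moment
`T⁻¹∫_T^{2T}|ζA|² = 𝒬_T(a) + o(1)`, `θ < ½`) implies the first relation of Proposition B,
`𝓘(M_θ) = 𝒬_T(a) − 1 + o(1)` uniformly over admissible `a` with `a(1) = 1` — spelled out: for
`0 < θ < ½`, every family of implied constants `C` and every `ε > 0` there is `T₀` with
`|𝓘(M_θ) − (𝒬_T(a) − 1)| ≤ ε` for all `T ≥ T₀` and all `a` with `a(1) = 1`, `|a(n)| ≤ C(δ)n^δ`
(`δ > 0`, `n ≥ 1`), `N = ⌊T^θ⌋` (the statement formerly vendored as the named fact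
`Radziwill2012_propB_asymptotic`; D-0026 review 2026-08-15: not an independent published result,
so it is a theorem here and no longer a `def`): expand
`|1 − ζM|² = 1 − 2Re ζM + |ζM|²` and use the first moment `T⁻¹∫_T^{2T} ζM_θ = a(1) + O(T^{-(1−2θ)/8})`
(`PropBAsymptotic.norm_firstMoment_sub_le` with `A_½ ≤ 2C(δ)T^{θ(½+δ)}`, `δ = (1−2θ)/(8θ)`).
This is the derivation indicated in [Radziwill2012, p. 3] ("using an asymptotic formula for `𝓘`,
due to Balasubramanian, Conrey and Heath-Brown"). [cite: Radziwill2012, Proposition B] -/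
theorem Radziwill2012_propB_asymptotic_of_BCH
    (hBCH : BalasubramanianConreyHeathBrown1985_meanSquare) :
    ∀ θ : ℝ, 0 < θ → θ < 1 / 2 → ∀ C : ℝ → ℝ, ∀ ε : ℝ, 0 < ε →
      ∃ T₀ : ℝ, ∀ T : ℝ, T₀ ≤ T →
        ∀ a : ℕ → ℂ, a 1 = 1 →
          (∀ δ : ℝ, 0 < δ → ∀ n : ℕ, 1 ≤ n → ‖a n‖ ≤ C δ * (n : ℝ) ^ δ) →
            |mollificationDefect (dirichletMollifier a ⌊T ^ θ⌋₊) T -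
                (bchQuadForm T ⌊T ^ θ⌋₊ a - 1)| ≤ ε := by
  intro θ hθ hθ2 C ε hε
  -- exponents
  set δ : ℝ := (1 - 2 * θ) / (8 * θ) with hδ
  have hδ0 : 0 < δ := div_pos (by linarith) (by positivity)
  set η : ℝ := (1 - 2 * θ) / 8 with hη
  have hη0 : 0 < η := by rw [hη]; linarith
  have hexp1 : θ * (1 / 2 + δ) = 1 - η - 3 / 4 := by
    rw [hδ, hη]; field_simp; ring
  -- constants
  set K : ℝ := max (C δ) 1 with hK
  have hK1 : 1 ≤ K := le_max_right _ _
  have hK0 : 0 ≤ K := by linarith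
  have hC1 := emC_nonneg
  set B : ℝ := (19 + emC) * (2 * K) with hB
  have hB0 : 0 < B := by positivity
  -- the Balasubramanian–Conrey–Heath-Brown asymptotic with `ε/2`
  obtain ⟨T₁, hT₁⟩ := hBCH θ hθ hθ2 C (ε / 2) (by linarith)
  -- the threshold for the first moment: `B T^{-η} ≤ ε/4` as soon as `T^η ≥ 4B/ε`
  set T₂ : ℝ := (4 * B / ε) ^ (1 / η) with hT₂
  have hT₂0 : 0 ≤ T₂ := Real.rpow_nonneg (by positivity) _
  refine ⟨max (max T₁ T₂) 2, fun T hT a ha1 ha ↦ ?_⟩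
  have hTT₁ : T₁ ≤ T := le_trans (le_trans (le_max_left _ _) (le_max_left _ _)) hT
  have hTT₂ : T₂ ≤ T := le_trans (le_trans (le_max_right _ _) (le_max_left _ _)) hT
  have hT2 : (2 : ℝ) ≤ T := le_trans (le_max_right _ _) hT
  have hT0 : 0 < T := by linarith
  have hT1 : (1 : ℝ) ≤ T := by linarith
  set N := ⌊T ^ θ⌋₊ with hN
  have hN1 : 1 ≤ N := Nat.le_floor (by simpa using Real.one_le_rpow hT1 hθ.le)
  have hNle : (N : ℝ) ≤ T ^ θ := Nat.floor_le (Real.rpow_nonneg hT0.le _)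
  -- the coefficient sum `A_½ ≤ 2K T^{θ(1/2+δ)}`
  have ha' : ∀ n : ℕ, 1 ≤ n → ‖a n‖ ≤ K * (n : ℝ) ^ δ := fun n hn ↦
    (ha δ hδ0 n hn).trans (mul_le_mul_of_nonneg_right (le_max_left _ _)
      (Real.rpow_nonneg (Nat.cast_nonneg n) _))
  set A : ℝ := ∑ d ∈ Finset.Icc 1 N, ‖a d‖ * (d : ℝ) ^ (-(1 / 2 : ℝ)) with hA
  have hAle : A ≤ 2 * K * T ^ (1 - η - 3 / 4) := by
    refine (coeffHalfSum_le hK0 hδ0.le ha' N).trans ?_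
    refine mul_le_mul_of_nonneg_left ?_ (by positivity)
    calc (N : ℝ) ^ (1 / 2 + δ) ≤ (T ^ θ) ^ (1 / 2 + δ) :=
          Real.rpow_le_rpow (Nat.cast_nonneg N) hNle (by linarith)
      _ = T ^ (1 - η - 3 / 4) := by rw [← Real.rpow_mul hT0.le, hexp1]
  -- the first moment: `‖∫ ζ M - T‖ ≤ B T^{1-η} ≤ (ε/4) T`
  set J : ℂ := ∫ t in T..(2 * T), riemannZeta (1 / 2 + t * I) * mollifierLine a N t with hJ
  have hFM : ‖J - T‖ ≤ B * T ^ (1 - η) := by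
    have h := norm_firstMoment_sub_le a hN1 hT2
    rw [ha1, one_mul] at h
    refine h.trans ?_
    have hpow : T ^ (1 - η - 3 / 4) * T ^ (3 / 4 : ℝ) = T ^ (1 - η) := by
      rw [← Real.rpow_add hT0]; ring_nf
    calc (19 + emC) * A * T ^ (3 / 4 : ℝ)
        ≤ (19 + emC) * (2 * K * T ^ (1 - η - 3 / 4)) * T ^ (3 / 4 : ℝ) := by gcongr
      _ = B * (T ^ (1 - η - 3 / 4) * T ^ (3 / 4 : ℝ)) := by rw [hB]; ring
      _ = B * T ^ (1 - η) := by rw [hpow]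
  have hTη : 4 * B / ε ≤ T ^ η := by
    have h1 : T₂ ^ η ≤ T ^ η := Real.rpow_le_rpow hT₂0 hTT₂ hη0.le
    have h2 : T₂ ^ η = 4 * B / ε := by
      rw [hT₂, ← Real.rpow_mul (by positivity), one_div_mul_cancel hη0.ne', Real.rpow_one]
    rw [h2] at h1
    exact h1
  have hsmall : B * T ^ (1 - η) ≤ ε / 4 * T := by
    have h1 : T ^ (1 - η) * T ^ η = T := by
      rw [← Real.rpow_add hT0]; simp
    have h2 : B ≤ ε / 4 * T ^ η := by
      have h3 := (div_le_iff₀ hε).1 hTη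
      linarith
    calc B * T ^ (1 - η) ≤ ε / 4 * T ^ η * T ^ (1 - η) :=
          mul_le_mul_of_nonneg_right h2 (Real.rpow_nonneg hT0.le _)
      _ = ε / 4 * T := by rw [mul_assoc, mul_comm (T ^ η), h1]
  have hJ1 : ‖J - T‖ ≤ ε / 4 * T := hFM.trans hsmall
  have hre : |1 - T⁻¹ * J.re| ≤ ε / 4 := by
    have h1 : |J.re - T| ≤ ε / 4 * T := by
      have h2 := Complex.abs_re_le_norm (J - T)
      simp only [Complex.sub_re, Complex.ofReal_re] at h2
      exact h2.trans hJ1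
    have h2 : 1 - T⁻¹ * J.re = T⁻¹ * (T - J.re) := by field_simp
    rw [h2, abs_mul, abs_of_pos (inv_pos.2 hT0), abs_sub_comm]
    calc T⁻¹ * |J.re - T| ≤ T⁻¹ * (ε / 4 * T) :=
          mul_le_mul_of_nonneg_left h1 (inv_nonneg.2 hT0.le)
      _ = ε / 4 := by field_simp
  -- the second moment (the named fact)
  set S : ℝ := ∫ t in T..(2 * T),
    ‖riemannZeta (1 / 2 + t * I) * dirichletMollifier a N (1 / 2 + t * I)‖ ^ 2 with hS
  have hQ : |T⁻¹ * S - bchQuadForm T N a| ≤ ε / 2 := hT₁ T hTT₁ a ha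
  -- the `L²` expansion
  have hcont : Continuous fun t : ℝ ↦
      riemannZeta (1 / 2 + t * I) * dirichletMollifier a N (1 / 2 + t * I) :=
    continuous_riemannZeta_half_line.mul (continuous_mollifierLine a N)
  have hL2 : ∫ t in T..(2 * T),
      ‖1 - riemannZeta (1 / 2 + t * I) * dirichletMollifier a N (1 / 2 + t * I)‖ ^ 2 =
        T - 2 * J.re + S :=
    integral_norm_one_sub_sq hcont T
  have hdef : mollificationDefect (dirichletMollifier a N) T = T⁻¹ * (T - 2 * J.re + S) := by
    unfold mollificationDefect
    rw [hL2]
  rw [hdef]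
  have hid : T⁻¹ * (T - 2 * J.re + S) - (bchQuadForm T N a - 1) =
      2 * (1 - T⁻¹ * J.re) + (T⁻¹ * S - bchQuadForm T N a) := by
    field_simp
    ring
  rw [hid]
  calc |2 * (1 - T⁻¹ * J.re) + (T⁻¹ * S - bchQuadForm T N a)|
      ≤ |2 * (1 - T⁻¹ * J.re)| + |T⁻¹ * S - bchQuadForm T N a| := abs_add_le _ _
    _ = 2 * |1 - T⁻¹ * J.re| + |T⁻¹ * S - bchQuadForm T N a| := by
        rw [abs_mul, abs_of_pos (by norm_num : (0 : ℝ) < 2)]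
    _ ≤ 2 * (ε / 4) + ε / 2 := by gcongr
    _ = ε := by ring

/-- **Radziwiłł 2012, Proposition B, from the single named fact
`BalasubramanianConreyHeathBrown1985_meanSquare`**: `𝓘(M_θ) ≥ 1/θ + o(1)` for `θ < ½`
(`Radziwill2012_propB_asymptotic_of_BCH`, Soundararajan's discharged bound
`Radziwill2012_propB_quadForm_holds`, and `Radziwill2012_propB_of_parts`).
[cite: Radziwill2012, Proposition B] -/
theorem Radziwill2012_propB_of_BCH (hBCH : BalasubramanianConreyHeathBrown1985_meanSquare) :
    Radziwill2012_propB :=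
  Radziwill2012_propB_of_asymptotic (Radziwill2012_propB_asymptotic_of_BCH hBCH)

-- **Theorem 1 along the printed route, from Selberg's lemma, Bombieri–Friedlander's Lemma 2 and
-- the Balasubramanian–Conrey–Heath-Brown asymptotic** [Radziwill2012, §4] (the three deep inputs of
-- the paper: Proposition A from Lemma 2, Lemma 5 from Selberg's lemma, Proposition B from the BCH
-- fact). Kept anonymous: as a statement it is `Radziwill2012_thm1_of_selberg_of_lemma2 hS h2`
-- (`MollifierLimitationsSmallTheta.lean`) under a redundant third hypothesis — its former name
-- `Radziwill2012_thm1_of_selberg_lemma2_BCH` was deleted (dedup-00596, dedup-00672); as a term it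
-- records, and re-checks at every build, that the printed arrows compose literally to
-- `Radziwill2012_thm1`.
example (hS : Radziwill2012_selbergLemma) (h2 : Radziwill2012_lemma2)
    (hBCH : BalasubramanianConreyHeathBrown1985_meanSquare) : Radziwill2012_thm1 :=
  Radziwill2012_thm1_of_inputs (Radziwill2012_propA_of_lemma2 h2)
    (Radziwill2012_lemma5_of_selbergLemma hS) (Radziwill2012_propB_of_BCH hBCH)

end Literature.Barriers.RiemannHypothesis
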